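import Summits.QuantumAdvantage.QuantumAdvantage.Theses.RingFrame
import Summits.QuantumAdvantage.AdviceFreeQNC0.WalkTransport
import HarnessLib

/-!
# Route RingFrame, aside `RingHardLogDeg` (stmt-QuantumAdvantage-19453): the aside is its WALK form —
# ring hardness at degree `log₄ n − log₄(log₂ n + 1) − 3` follows from walk-game hardness at the same
# degree (transport through the affine chart, all `n`)

The aside `RingHardLogDeg` of route RingFrame asks for an absolute `θ < 1` such that every tuple of
`𝔽₂`-polynomials of degree `≤ log₄ n − log₄(log₂ n + 1) − 3` solves the `n`-cycle relation
`RingHLF.Rel` on at most `θ·2ⁿ` patterns (the Viola–Wigderson regime `n/4^d ≥ 16 log₂ n`, one rung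
above Theorem V's `c·log n / log log n`, `WalkHardLogOverLogLog.lean`).  This file isolates the
transport, so that any walk-game theorem at that degree closes the aside by a one-liner:

* `asideDeg_pos` — for `N ≥ 4⁸` the aside's degree `log₄ N − log₄(log₂ N + 1) − 3` is `≥ 1`
  (needed by the chart's degree-`1` correction `tGuess`);
* **`ringHardLogDeg_of_walkHard`** — if for some `θ' < 1` and all large `n` every charge-`(n+2)`
  walk strategy `y` on `n` bits with `HasDeg (y g) (log₄(n+1) − log₄(log₂(n+1) + 1) − 3)` wins on
  `≤ θ'·2ⁿ` inputs, then `RingHardLogDeg` holds with `θ = (1 + θ')/2` (the transported strategy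
  `y_g(u) = [P_g(xOfU u) = 1] ⊕ tGuess(xOfU u)_g` has the same degree — `hasDeg_transport` — and wins at
  `u = uVec x` exactly when `P` solves the relation at the odd-class pattern `x`; the even class
  contributes `≤ 2ⁿ`; proof shape of `ringHard_two_of_walkHard`, `WalkTransport.lean`).

Intended consumer: the rectangle mechanism of `CrossTeamRectangles.lean` / memo PROVER3-MEMO-gen7 §2
(walk hardness at this degree ⟸ cross-team loss at the balanced cut ⟸ good-rectangle density).
The cell's bookkeeping (prover qn-prover-3 gen 7, 2026-08-27).  WHAT THIS IS NOT: the walk-form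
hypothesis is OPEN (it is the aside in walk coordinates); nothing is claimed about it; α untouched.
-/

-- the sub-problem namespace `Summit.QuantumAdvantage.QuantumAdvantage` repeats the summit name by design (D-0017)
set_option linter.dupNamespace false

noncomputable section

namespace Summit.QuantumAdvantage.QuantumAdvantage.Theorems

open Finset Summit.QuantumAdvantage.AdviceFreeQNC0
open Literature.Computability.QuantumComplexity Literature.Computability.QuantumComplexity.RingHLF
open Literature.Computability.MetaComplexity Literature.Computability.MetaComplexity.Smolensky

/-! ### Degree bookkeeping -/

/-- `2m + 8 < 4^m` for `m ≥ 5`. -/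
private theorem two_mul_add_lt_four_pow {m : ℕ} (hm : 5 ≤ m) : 2 * m + 8 < 4 ^ m := by
  have h2 : m < 2 ^ m := Nat.lt_two_pow_self
  have h32 : 32 ≤ 2 ^ m := by
    calc (32 : ℕ) = 2 ^ 5 := by norm_num
      _ ≤ 2 ^ m := Nat.pow_le_pow_right (by norm_num) hm
  have h4 : 4 ^ m = 2 ^ m * 2 ^ m := by
    rw [← mul_pow]
    norm_num
  rw [h4]
  nlinarith

/-- **The aside's degree is positive for `N ≥ 4⁸`**: `1 ≤ log₄ N − log₄(log₂ N + 1) − 3`. -/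
theorem asideDeg_pos {N : ℕ} (hN : 4 ^ 8 ≤ N) :
    1 ≤ Nat.log 4 N - Nat.log 4 (Nat.log 2 N + 1) - 3 := by
  set k := Nat.log 4 N with hk
  have hk8 : 8 ≤ k := by
    rw [hk]
    exact Nat.le_log_of_pow_le (by norm_num) hN
  -- `log₂ N + 1 ≤ 2k + 2`
  have hNlt : N < 4 ^ (k + 1) := Nat.lt_pow_succ_log_self (by norm_num) N
  have hlog2 : Nat.log 2 N < 2 * k + 2 := by
    have h : N < 2 ^ (2 * k + 2) := by
      have e : (2 : ℕ) ^ (2 * k + 2) = 4 ^ (k + 1) := by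
        rw [show 2 * k + 2 = 2 * (k + 1) by ring, pow_mul]; norm_num
      rw [e]; exact hNlt
    exact Nat.log_lt_of_lt_pow (by omega) h
  -- `log₄ (log₂ N + 1) ≤ k − 4`
  have hsmall : Nat.log 4 (Nat.log 2 N + 1) ≤ k - 4 := by
    have h1 : Nat.log 4 (Nat.log 2 N + 1) ≤ Nat.log 4 (2 * k + 2) := Nat.log_mono_right (by omega)
    have h2 : Nat.log 4 (2 * k + 2) < k - 3 := by
      refine Nat.log_lt_of_lt_pow (by omega) ?_
      have := two_mul_add_lt_four_pow (m := k - 3) (by omega)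
      have e : 2 * (k - 3) + 8 = 2 * k + 2 := by omega
      rw [e] at this
      exact this
    omega
  omega

/-! ### The transport -/

/-- **`RingHardLogDeg` is its walk form.**  If for some `θ' < 1`, for all large `n`, every
charge-`(n+2)` walk strategy on `n` bits of `𝔽₂`-degree `≤ log₄(n+1) − log₄(log₂(n+1) + 1) − 3`
wins on at most `θ'·2ⁿ` inputs, then the aside `RingHardLogDeg` holds (with `θ = (1 + θ')/2`). -/
theorem ringHardLogDeg_of_walkHard
    (h : ∃ θ : ℝ, θ < 1 ∧ ∃ n₀ : ℕ, ∀ n ≥ n₀, ∀ y : Fin (n + 1) → (Fin n → Bool) → Bool,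
      (∀ g, HasDeg (y g) (Nat.log 4 (n + 1) - Nat.log 4 (Nat.log 2 (n + 1) + 1) - 3)) →
        ((univ.filter fun u : Fin n → Bool => ringWinU (n + 2) y u = true).card : ℝ) ≤
          θ * (2 : ℝ) ^ n) :
    Summit.QuantumAdvantage.QuantumAdvantage.Theses.RingFrame.RingHardLogDeg := by
  classical
  obtain ⟨θ', hθ', n₀, hn₀⟩ := h
  refine ⟨(1 + θ') / 2, by linarith, max (n₀ + 1) (4 ^ 8), fun N hN P hP => ?_⟩
  have hN8 : 4 ^ 8 ≤ N := le_trans (le_max_right _ _) hN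
  obtain ⟨n, rfl⟩ : ∃ n, N = n + 1 := ⟨N - 1, by have : (1 : ℕ) ≤ 4 ^ 8 := Nat.one_le_pow _ _ (by norm_num); omega⟩
  have hn₀n : n₀ ≤ n := by have := le_max_left (n₀ + 1) (4 ^ 8); omega
  have hn4 : 4 ≤ n := by
    have : (4 : ℕ) ^ 8 = 65536 := by norm_num
    omega
  -- the transported walk strategy and its degree
  set d := Nat.log 4 (n + 1) - Nat.log 4 (Nat.log 2 (n + 1) + 1) - 3 with hd
  have hd1 : 1 ≤ d := asideDeg_pos hN8
  set z : (Fin (n + 1) → Bool) → (Fin (n + 1) → Bool) := fun x i => decide (P i x = 1) with hz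
  set y : Fin (n + 1) → (Fin n → Bool) → Bool :=
    fun g u => xor (z (xOfU u) g) (tGuess (xOfU u) g) with hy
  have hdeg : ∀ g, HasDeg (y g) d := fun g => hasDeg_transport hd1 (P g) (hP g) g
  have hwin := hn₀ n hn₀n y hdeg
  -- split the solved patterns by the parity of the number of zeros
  set Sx := univ.filter fun x : Fin (n + 1) → Bool => Rel x (z x) with hSx
  set OddZ : (Fin (n + 1) → Bool) → Prop := fun x =>
    (univ.filter fun j : Fin (n + 1) => x j = false).card % 2 = 1 with hOddZ
  have hsplit : Sx.card = (Sx.filter OddZ).card + (Sx.filter fun x => ¬ OddZ x).card :=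
    (Finset.card_filter_add_card_filter_not _).symm
  have heven : (Sx.filter fun x => ¬ OddZ x).card ≤ 2 ^ n := by
    refine le_trans (Finset.card_le_card ?_) card_even_class_le
    intro x hx
    rw [mem_filter] at hx ⊢
    exact ⟨mem_univ _, hx.2⟩
  have hodd : (Sx.filter OddZ).card ≤
      (univ.filter fun u : Fin n → Bool => ringWinU (n + 2) y u = true).card := by
    refine Finset.card_le_card_of_injOn uVec ?_ ?_
    · intro x hx
      rw [Finset.mem_coe, mem_filter, hSx, mem_filter] at hx
      rw [Finset.mem_coe, mem_filter]
      exact ⟨mem_univ _, (rel_iff_ringWinU (by omega) x hx.2 z).1 hx.1.2⟩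
    · intro x₁ hx₁ x₂ hx₂ h
      rw [Finset.mem_coe, mem_filter] at hx₁ hx₂
      rw [← xOfU_uVec (by omega) x₁ hx₁.2, ← xOfU_uVec (by omega) x₂ hx₂.2, h]
  -- arithmetic
  have hS : (Sx.card : ℝ) ≤ 2 ^ n + θ' * 2 ^ n := by
    have h1 : (Sx.card : ℝ) ≤ ((Sx.filter fun x => ¬ OddZ x).card : ℝ) + ((Sx.filter OddZ).card : ℝ) := by
      rw [hsplit]; push_cast; linarith
    have h2 : ((Sx.filter fun x => ¬ OddZ x).card : ℝ) ≤ 2 ^ n := by exact_mod_cast heven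
    have h3 : ((Sx.filter OddZ).card : ℝ) ≤ θ' * 2 ^ n := le_trans (by exact_mod_cast hodd) hwin
    linarith
  have hpow : (2 : ℝ) ^ (n + 1) = 2 * 2 ^ n := by ring
  calc (Sx.card : ℝ) ≤ 2 ^ n + θ' * 2 ^ n := hS
    _ = (1 + θ') / 2 * (2 : ℝ) ^ (n + 1) := by rw [hpow]; ring

end Summit.QuantumAdvantage.QuantumAdvantage.Theorems

end
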